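import Mathlib
import HarnessLib
import Summits.HubbardSuperconductivity.HubbardSuperconductivity.Theorems.WeakCouplingBCSKlCertQuadOrder1

/-!
# Route `WeakCouplingBCS` — crux `WcbcsBcsConstruction` (stmt-HubbardSuperconductivity-2010), stub `stub_klPointEnclosure` (Penc):
# chains of tangent-model cells and the assembled `∫₀^{π/4} w_μ Φ²` certificate

Continuation of `WeakCouplingBCSKlCertQuadOrder1.lean` (cell bracket `DOSCell.g1Lo/g1Hi`, soundness `DOSCell.int1_mem`):

* `t1LowerSum / t1UpperSum` — the brackets of `∫ w_μ Φ²` over a chain of cells (outward `2⁻³²` rounding) and **`t1chain_bounds`**: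
  `chainOK μq s l = true → t1LowerSum ≤ ∫_s^{end} w_μ Φ² ≤ t1UpperSum` (cos-only table);
* `t1LowerSum_append`, `t1UpperSum_append` and the gluing lemma `chainOK_glue` — chunking, so that a long chain is certified by several
  `decide +kernel` calls each under the default heartbeat budget;
* **`quarter_t1integral_mem`** — `∫₀^{π/4} w_μ Φ²` from a short certified chain (ends below `π/4`) and a long one (ends above), same interface as
  the zero-order `quarter_tintegral_mem` of `WeakCouplingBCSKlCertTrigQuadratureChain.lean`.

Everything is proved. Honest framing: quadrature soundness only; no enclosure of any record is claimed here. [folklore]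
-/

noncomputable section

-- the tree's namespace `Summit.<Summit>.<Problem>.Theorems` repeats the summit name by design (D-0017)
set_option linter.dupNamespace false

namespace Summit.HubbardSuperconductivity.HubbardSuperconductivity.Theorems.KlCertQuad

open Real Set MeasureTheory intervalIntegral CwKLChiralWindow Literature.MathematicalPhysics.QuantumLattice

/-! ### Chains of tangent-model cells -/

/-- Lower bracket of `∫ w_μ Φ²` over a chain of cells (tangent model, outward `2⁻³²` rounding). [folklore] -/
def t1LowerSum (t : KLTrig) : List DOSCell → ℚ
  | [] => 0
  | c :: l => dyDown (c.g1Lo t) + t1LowerSum t l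

/-- Upper bracket of `∫ w_μ Φ²` over a chain of cells (tangent model, outward `2⁻³²` rounding). [folklore] -/
def t1UpperSum (t : KLTrig) : List DOSCell → ℚ
  | [] => 0
  | c :: l => dyUp (c.g1Hi t) + t1UpperSum t l

section T1Chain

variable {μq : ℚ} (hμ₁ : -4 < ((μq : ℚ) : ℝ)) (hμ₂ : ((μq : ℚ) : ℝ) < 0) (t : KLTrig)
include hμ₁ hμ₂

/-- The integrand `w_μ Φ²` is interval integrable. [folklore] -/
theorem intervalIntegrable_g1 (s u : ℝ) :
    IntervalIntegrable (fun θ => fermiPolarDOS (μq : ℝ) θ * t.eval θ ^ 2) MeasureTheory.volume s u :=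
  ((continuous_fermiPolarDOS hμ₁ hμ₂).mul ((kl_tr_continuous_eval t).pow 2)).intervalIntegrable _ _

variable (ht : t.sinC = [])
include ht

/-- **Tangent-model chains are sound for `∫ w_μ Φ²`.** [folklore] -/
theorem t1chain_bounds : ∀ (l : List DOSCell) (s : ℚ), chainOK μq s l = true →
    ((t1LowerSum t l : ℚ) : ℝ) ≤ ∫ θ in ((s : ℚ) : ℝ)..((endOf s l : ℚ) : ℝ), fermiPolarDOS (μq : ℝ) θ * t.eval θ ^ 2 ∧
      ∫ θ in ((s : ℚ) : ℝ)..((endOf s l : ℚ) : ℝ), fermiPolarDOS (μq : ℝ) θ * t.eval θ ^ 2 ≤ ((t1UpperSum t l : ℚ) : ℝ)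
  | [], s, _ => by simp [t1LowerSum, t1UpperSum, endOf]
  | c :: l, s, h => by
    simp only [chainOK, Bool.and_eq_true, decide_eq_true_eq] at h
    obtain ⟨⟨hs, hc⟩, hl⟩ := h
    obtain ⟨ih₁, ih₂⟩ := t1chain_bounds l c.b hl
    obtain ⟨hc₁, hc₂⟩ := DOSCell.int1_mem hμ₁ hμ₂ hc t ht
    have hdn : ((dyDown (c.g1Lo t) : ℚ) : ℝ) ≤ c.g1Lo t := by exact_mod_cast dyDown_le _
    have hup : ((c.g1Hi t : ℚ) : ℝ) ≤ dyUp (c.g1Hi t) := by exact_mod_cast le_dyUp _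
    rw [endOf, t1LowerSum, t1UpperSum, ← hs]
    have hsplit := (intervalIntegral.integral_add_adjacent_intervals
      (intervalIntegrable_g1 hμ₁ hμ₂ t ((c.a : ℚ) : ℝ) ((c.b : ℚ) : ℝ))
      (intervalIntegrable_g1 hμ₁ hμ₂ t ((c.b : ℚ) : ℝ) ((endOf c.b l : ℚ) : ℝ))).symm
    rw [hsplit]
    push_cast
    constructor <;> linarith

end T1Chain

/-- `t1LowerSum` of a concatenation. [folklore] -/
theorem t1LowerSum_append (t : KLTrig) (l₁ l₂ : List DOSCell) :
    t1LowerSum t (l₁ ++ l₂) = t1LowerSum t l₁ + t1LowerSum t l₂ := by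
  induction l₁ with
  | nil => simp [t1LowerSum]
  | cons c l ih => simp [t1LowerSum, ih, add_assoc]

/-- `t1UpperSum` of a concatenation. [folklore] -/
theorem t1UpperSum_append (t : KLTrig) (l₁ l₂ : List DOSCell) :
    t1UpperSum t (l₁ ++ l₂) = t1UpperSum t l₁ + t1UpperSum t l₂ := by
  induction l₁ with
  | nil => simp [t1UpperSum]
  | cons c l ih => simp [t1UpperSum, ih, add_assoc]

/-- **Gluing two certified chains** (implication form used by the chunked data files): a certified chain from `s` ending at `m`
followed by a certified chain from `m` is a certified chain from `s`, ending where the second ends. [folklore] -/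
theorem chainOK_glue {μq m : ℚ} {l₂ : List DOSCell} :
    ∀ {l₁ : List DOSCell} {s : ℚ}, chainOK μq s l₁ = true → endOf s l₁ = m → chainOK μq m l₂ = true →
      chainOK μq s (l₁ ++ l₂) = true ∧ endOf s (l₁ ++ l₂) = endOf m l₂
  | [], s, _, he, h₂ => by
    simp only [endOf] at he
    subst he
    simpa using h₂
  | c :: l, s, h₁, he, h₂ => by
    simp only [chainOK, Bool.and_eq_true, decide_eq_true_eq] at h₁
    obtain ⟨⟨hs, hc⟩, hl⟩ := h₁
    rw [endOf] at he
    obtain ⟨ih₁, ih₂⟩ := chainOK_glue hl he h₂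
    refine ⟨?_, ?_⟩
    · simp only [List.cons_append, chainOK, hs, hc, ih₁, decide_true, Bool.and_self]
    · simp only [List.cons_append, endOf, ih₂]

/-- A certified chain moves right: `s ≤ endOf s l`. [folklore] -/
theorem le_endOf_of_chainOK (μq : ℚ) : ∀ (l : List DOSCell) (s : ℚ), chainOK μq s l = true → s ≤ endOf s l
  | [], s, _ => by simp [endOf]
  | c :: l, s, h => by
    simp only [chainOK, Bool.and_eq_true, decide_eq_true_eq] at h
    obtain ⟨⟨hs, hc⟩, hl⟩ := h
    obtain ⟨⟨-, hab, -⟩, -⟩ := DOSCell.ok_spec hc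
    rw [endOf, ← hs]
    exact hab.trans (le_endOf_of_chainOK μq l c.b hl)

/-- **The assembled tangent-model certificate for `∫₀^{π/4} w_μ Φ²`** from a short chain (ending below `π/4`: lower bound, the
integrand being non-negative) and a long chain (ending above `π/4`: upper bound). [folklore] -/
theorem quarter_t1integral_mem {μq : ℚ} (hμ₁ : -4 < ((μq : ℚ) : ℝ)) (hμ₂ : ((μq : ℚ) : ℝ) < 0) (t : KLTrig) (ht : t.sinC = [])
    {short long : List DOSCell} (hshort : chainOK μq 0 short = true) (hlong : chainOK μq 0 long = true)
    (he₁ : endOf 0 short ≤ pi4Lo) (he₂ : pi4Hi ≤ endOf 0 long) :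
    ((t1LowerSum t short : ℚ) : ℝ) ≤ ∫ θ in (0 : ℝ)..(π / 4), fermiPolarDOS (μq : ℝ) θ * t.eval θ ^ 2 ∧
      ∫ θ in (0 : ℝ)..(π / 4), fermiPolarDOS (μq : ℝ) θ * t.eval θ ^ 2 ≤ ((t1UpperSum t long : ℚ) : ℝ) := by
  obtain ⟨h₁, -⟩ := t1chain_bounds hμ₁ hμ₂ t ht short 0 hshort
  obtain ⟨-, h₂⟩ := t1chain_bounds hμ₁ hμ₂ t ht long 0 hlong
  push_cast at h₁ h₂
  have he₁' : ((endOf 0 short : ℚ) : ℝ) ≤ π / 4 :=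
    (show ((endOf 0 short : ℚ) : ℝ) ≤ pi4Lo by exact_mod_cast he₁).trans pi4Lo_lt.le
  have he₂' : π / 4 ≤ ((endOf 0 long : ℚ) : ℝ) := lt_pi4Hi.le.trans (by exact_mod_cast he₂)
  have h0₁ : (0 : ℝ) ≤ ((endOf 0 short : ℚ) : ℝ) := by exact_mod_cast le_endOf_of_chainOK μq short 0 hshort
  have hg0 : ∀ θ, 0 ≤ fermiPolarDOS (μq : ℝ) θ * t.eval θ ^ 2 :=
    fun θ => mul_nonneg (fermiPolarDOS_pos hμ₁ hμ₂ θ).le (sq_nonneg _)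
  have hmono : ∀ {s u : ℝ}, 0 ≤ s → s ≤ u →
      ∫ θ in (0 : ℝ)..s, fermiPolarDOS (μq : ℝ) θ * t.eval θ ^ 2 ≤
        ∫ θ in (0 : ℝ)..u, fermiPolarDOS (μq : ℝ) θ * t.eval θ ^ 2 :=
    fun hs hsu => intervalIntegral.integral_mono_interval le_rfl hs hsu (Filter.Eventually.of_forall hg0)
      (intervalIntegrable_g1 hμ₁ hμ₂ t _ _)
  constructor
  · exact h₁.trans (hmono h0₁ he₁')
  · exact (hmono (by linarith [Real.pi_pos]) he₂').trans h₂

end Summit.HubbardSuperconductivity.HubbardSuperconductivity.Theorems.KlCertQuad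

end
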